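import Literature.RepresentationTheory.Virasoro.SingularVectors

/-!
# The character of the Kac quotient `K_{r,s}` from a singular vector

We compute the character of the Kac quotient `K_{r,s} = V(c(t), h_{r,s}(t)) / ⟨primary vectors of
weight h_{r,s} + rs⟩` of `Literature.RepresentationTheory.Virasoro.VermaModule` from the
structure theory of Verma modules proved in this directory (PBW theorem, torsion-freeness,
uniqueness of singular vectors): **if** `V(c(t), h_{r,s}(t))` has a singular vector `w` of level
`rs` (a non-zero primary vector of weight `h_{r,s}(t) + rs`; Iohara–Koga Proposition 5.2, whose
proof rests on the Kac determinant formula, Theorem 4.2 loc. cit.), **then**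

  `dim (K_{r,s})_{h_{r,s}+n} = p(n) - p(n - rs)`

(`Verma.kacCharacter_of_singular`): the quotiented submodule is `U(Vir)·w ≅ V(c, h_{r,s}+rs)`
(`Verma.primarySpan_eq_generated`, `Verma.range_lift_eq_generated`, `Verma.lift_injective`), whose
weight spaces have dimensions `p(n - rs)` (`Verma.gradedDim_eq_card`). Consequently the named fact
`KacCharacter` (Pearce–Rasmussen–Zuber §2.2) is EQUIVALENT to the existence of these singular
vectors for all `t ≠ 0`, `r, s ≥ 1` (`KacCharacter_iff_exists_singular`); what remains to
discharge it is exactly Iohara–Koga Proposition 5.2 (existence), i.e. the vanishing of the Kac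
determinant `det(c(t), h_{r,s}(t))_{rs}` together with its non-vanishing at lower levels for
generic `t` (Theorem 4.2 loc. cit.).
-/

noncomputable section

namespace Literature.RepresentationTheory.Virasoro

namespace VirasoroRep

variable {c : ℂ} {V : Type*} [AddCommGroup V] [Module ℂ V] (R : VirasoroRep c V)

/-- Words commute with the quotient map. [folklore] -/
theorem pbwVector_mk (W : Submodule ℂ V) (hW : R.IsInvariant W) (l : List ℕ) (v : V) :
    (R.quotient W hW).pbwVector l (Submodule.Quotient.mk v) = Submodule.Quotient.mk (R.pbwVector l v) := by
  induction l with
  | nil => rfl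
  | cons k l ih => rw [pbwVector_cons, pbwVector_cons, ih, quotient_L_mk]

/-- PBW monomials commute with the quotient map. [folklore] -/
theorem partitionVector_mk (W : Submodule ℂ V) (hW : R.IsInvariant W) {N : ℕ} (p : Nat.Partition N)
    (v : V) :
    (R.quotient W hW).partitionVector p (Submodule.Quotient.mk v) =
      Submodule.Quotient.mk (R.partitionVector p v) :=
  R.pbwVector_mk W hW _ v

/-- The level spaces of a quotient are the images of the level spaces. [folklore] -/
theorem levelSpace_quotient (W : Submodule ℂ V) (hW : R.IsInvariant W) (v : V) (N : ℕ) :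
    (R.quotient W hW).levelSpace (Submodule.Quotient.mk v) N = (R.levelSpace v N).map W.mkQ := by
  rw [levelSpace, levelSpace, Submodule.map_span, ← Set.range_comp]
  congr 1
  apply congrArg Set.range
  funext p
  exact R.partitionVector_mk W hW p v

/-- The subrepresentation generated by `{0}` is trivial. [folklore] -/
theorem generated_zero : R.generated {(0 : V)} = ⊥ :=
  le_antisymm (R.generated_le (by simp) fun n x hx => by
    rw [Submodule.mem_bot] at hx; rw [hx, map_zero]; exact zero_mem _) bot_le

end VirasoroRep

namespace Verma

variable {c h : ℂ}

/-- **`U(Vir)·w` is the image of the universal map**: the subrepresentation generated by a primary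
vector `w` is the range of `Verma.lift` at `w`. [cite: IoharaKoga2011, Proposition 1.6 (1)] -/
theorem range_lift_eq_generated {h' : ℂ} {w : Verma c h} (hprim : (rep c h).IsPrimary w h') :
    LinearMap.range (lift (rep c h) hprim) = (rep c h).generated {w} := by
  rw [(rep c h).generated_singleton_eq_pbwSpan hprim, VirasoroRep.pbwSpan, ← Submodule.map_top,
    ← pbwSpan_hw_eq_top (c := c) (h := h'), VirasoroRep.pbwSpan, Submodule.map_span, ← Set.range_comp]
  congr 1
  apply congrArg Set.range
  funext l
  simp only [Function.comp_apply, lift_pbwVector, lift_hw]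

/-- The weight spaces of the image of an injective universal map are the images of the weight
spaces. [folklore] -/
theorem weightSpace_inf_range_lift {h' : ℂ} {w : Verma c h} (hprim : (rep c h).IsPrimary w h')
    (hinj : Function.Injective (lift (rep c h) hprim)) (μ : ℂ) :
    (rep c h).weightSpace μ ⊓ LinearMap.range (lift (rep c h) hprim) =
      ((rep c h').weightSpace μ).map (lift (rep c h) hprim) := by
  apply le_antisymm
  · rintro x ⟨hx, y, rfl⟩
    refine ⟨y, ?_, rfl⟩
    change y ∈ ((rep c h').L 0).eigenspace μ
    rw [Module.End.mem_eigenspace_iff]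
    apply hinj
    rw [lift_L, map_smul]
    exact Module.End.mem_eigenspace_iff.mp hx
  · rintro _ ⟨y, hy, rfl⟩
    refine ⟨?_, y, rfl⟩
    change lift (rep c h) hprim y ∈ ((rep c h).L 0).eigenspace μ
    rw [Module.End.mem_eigenspace_iff, ← lift_L,
      Module.End.mem_eigenspace_iff.mp (show y ∈ ((rep c h').L 0).eigenspace μ from hy), map_smul]

/-- Rank–nullity for the quotient map on a level space: the level-`n` space of `V(c,h)/M` has
dimension `p(n) - dim (V(c,h)_{h+n} ∩ M)`. [folklore] -/
theorem finrank_levelSpace_quotient (M : Submodule ℂ (Verma c h)) (hM : (rep c h).IsInvariant M)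
    (n : ℕ) :
    Module.finrank ℂ (((rep c h).quotient M hM).levelSpace (Submodule.Quotient.mk (hw c h)) n) =
      Fintype.card (Nat.Partition n) -
        Module.finrank ℂ ↥((rep c h).levelSpace (hw c h) n ⊓ M) := by
  set S := (rep c h).levelSpace (hw c h) n with hS
  haveI : FiniteDimensional ℂ S := by
    rw [hS, VirasoroRep.levelSpace]
    exact FiniteDimensional.span_of_finite ℂ (Set.finite_range _)
  have hSdim : Module.finrank ℂ S = Fintype.card (Nat.Partition n) :=
    finrank_span_eq_card (linearIndependent_partitionVector c h n)
  have hrn := LinearMap.finrank_range_add_finrank_ker (M.mkQ.domRestrict S)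
  rw [LinearMap.range_domRestrict, LinearMap.ker_domRestrict, Submodule.ker_mkQ, hSdim] at hrn
  have hker : Module.finrank ℂ (Submodule.comap S.subtype M) = Module.finrank ℂ ↥(S ⊓ M) := by
    have h1 : Submodule.comap S.subtype M = Submodule.comap S.subtype (S ⊓ M) := by
      ext x
      simp only [Submodule.mem_comap, Submodule.subtype_apply, Submodule.mem_inf, SetLike.coe_mem,
        true_and]
    rw [h1]
    exact LinearEquiv.finrank_eq (Submodule.comapSubtypeEquivOfLe inf_le_left)
  rw [(rep c h).levelSpace_quotient M hM (hw c h) n, ← hS]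
  omega

/-- **The level spaces of `V(c,h) / U(Vir)·w` for a singular vector `w` of level `N₀`** have
dimensions `p(n) - p(n - N₀)`: the quotiented submodule is the range of the injective universal map
`V(c, h + N₀) → V(c,h)` at `w`. [cite: IoharaKoga2011, eq. (4.20) and Proposition 5.1] -/
theorem finrank_levelSpace_quotient_primarySpan {N₀ : ℕ} {w : Verma c h} (hw0 : w ≠ 0)
    (hprim : (rep c h).IsPrimary w (h + (N₀ : ℕ))) (n : ℕ) :
    Module.finrank ℂ ((((rep c h).quotient ((rep c h).primarySpan (h + (N₀ : ℕ)))
        ((rep c h).isInvariant_generated _)).levelSpace (Submodule.Quotient.mk (hw c h)) n)) =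
      Fintype.card (Nat.Partition n) -
        (if N₀ ≤ n then Fintype.card (Nat.Partition (n - N₀)) else 0) := by
  -- the quotiented submodule is the range of the (injective) universal map at `w`
  have hwlev : w ∈ (rep c h).levelSpace (hw c h) N₀ := by
    rw [← (rep c h).weightSpace_eq_levelSpace isPrimary_hw generated_hw_eq_top N₀]
    exact hprim.mem_weightSpace
  have hinj : Function.Injective (lift (rep c h) hprim) := lift_injective hwlev hw0 hprim
  have hM : (rep c h).primarySpan (h + (N₀ : ℕ)) = LinearMap.range (lift (rep c h) hprim) := by
    rw [primarySpan_eq_generated hw0 hprim, range_lift_eq_generated]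
  rw [finrank_levelSpace_quotient]
  congr 1
  -- the weight spaces of the range
  have hinf : (rep c h).levelSpace (hw c h) n ⊓ (rep c h).primarySpan (h + (N₀ : ℕ)) =
      ((rep c (h + (N₀ : ℕ))).weightSpace (h + n)).map (lift (rep c h) hprim) := by
    rw [hM, ← (rep c h).weightSpace_eq_levelSpace isPrimary_hw generated_hw_eq_top n]
    exact weightSpace_inf_range_lift hprim hinj (h + n)
  rw [hinf, ← LinearEquiv.finrank_eq (Submodule.equivMapOfInjective _ hinj _)]
  split_ifs with hn
  · -- `N₀ ≤ n`: the weight `h + n = (h + N₀) + (n - N₀)` of `V(c, h + N₀)`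
    have e : (h + n : ℂ) = h + (N₀ : ℕ) + ((n - N₀ : ℕ) : ℂ) := by
      rw [Nat.cast_sub hn]; ring
    rw [e, (rep c (h + (N₀ : ℕ))).weightSpace_eq_levelSpace isPrimary_hw generated_hw_eq_top (n - N₀)]
    exact finrank_span_eq_card (linearIndependent_partitionVector c _ (n - N₀))
  · -- `n < N₀`: no such weight in `V(c, h + N₀)`
    have hbot : (rep c (h + (N₀ : ℕ))).genWeightSpace (h + n) = ⊥ := by
      refine (rep c (h + (N₀ : ℕ))).genWeightSpace_eq_bot isPrimary_hw generated_hw_eq_top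
        fun N' hN' => ?_
      have h1 : (N₀ : ℂ) + N' = n := by linear_combination hN'
      have h2 : N₀ + N' = n := by exact_mod_cast h1
      omega
    have hle : (rep c (h + (N₀ : ℕ))).weightSpace (h + n) = ⊥ := by
      rw [eq_bot_iff, ← hbot]
      exact Module.End.eigenspace_le_maxGenEigenspace
    rw [hle, finrank_bot]

/-- **The character of the Kac quotient from a singular vector**: if `V(c(t), h_{r,s}(t))` has a
non-zero primary vector of weight `h_{r,s}(t) + rs`, then
`dim (K_{r,s})_{h_{r,s}(t)+n} = p(n) - p(n - rs)`. [cite: PearceRasmussenZuber2006, §2.2 (χ_{r,s} = q^{-c/24} (q^{Δ_{r,s}} - q^{Δ_{r,-s}})/∏(1-qⁿ))]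
[cite: IoharaKoga2011, eq. (4.20) and Proposition 5.1] -/
theorem kacCharacter_of_singular (t : ℂ) (r s : ℕ)
    {w : Verma (centralChargeOf t) (kacWeight t r s)} (hw0 : w ≠ 0)
    (hprim : (rep (centralChargeOf t) (kacWeight t r s)).IsPrimary w (kacWeight t r s + (r * s : ℕ)))
    (n : ℕ) :
    (KacModule.rep t r s).gradedDim (kacWeight t r s + n) =
      Fintype.card (Nat.Partition n) -
        (if r * s ≤ n then Fintype.card (Nat.Partition (n - r * s)) else 0) := by
  rw [VirasoroRep.gradedDim, KacModule.genWeightSpace_eq_levelSpace]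
  exact finrank_levelSpace_quotient_primarySpan hw0 hprim n

/-- Without singular vectors the Kac quotient is the whole Verma module. [folklore] -/
theorem gradedDim_kacModule_of_forall_eq_zero (t : ℂ) (r s : ℕ)
    (H : ∀ w : Verma (centralChargeOf t) (kacWeight t r s),
      (rep (centralChargeOf t) (kacWeight t r s)).IsPrimary w (kacWeight t r s + (r * s : ℕ)) → w = 0)
    (n : ℕ) :
    (KacModule.rep t r s).gradedDim (kacWeight t r s + n) = Fintype.card (Nat.Partition n) := by
  have hM : (rep (centralChargeOf t) (kacWeight t r s)).primarySpan (kacWeight t r s + (r * s : ℕ)) = ⊥ := by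
    rw [VirasoroRep.primarySpan]
    have hset : {w | (rep (centralChargeOf t) (kacWeight t r s)).IsPrimary w (kacWeight t r s + (r * s : ℕ))} =
        {0} := by
      ext w
      exact ⟨fun hw => H w hw, fun hw => by
        rw [Set.mem_singleton_iff.mp hw]; exact (rep _ _).isPrimary_zero _⟩
    rw [hset, VirasoroRep.generated_zero]
  rw [VirasoroRep.gradedDim, KacModule.genWeightSpace_eq_levelSpace]
  have h1 := finrank_levelSpace_quotient ((rep (centralChargeOf t) (kacWeight t r s)).primarySpan
    (kacWeight t r s + (r * s : ℕ))) ((rep _ _).isInvariant_generated _) n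
  -- `primarySpan = ⊥` cannot be rewritten inside the (dependent) quotient; rewrite the `inf` only
  have h2 : (rep (centralChargeOf t) (kacWeight t r s)).levelSpace (hw (centralChargeOf t) (kacWeight t r s)) n ⊓
      (rep (centralChargeOf t) (kacWeight t r s)).primarySpan (kacWeight t r s + (r * s : ℕ)) = ⊥ := by
    rw [hM, inf_bot_eq]
  rw [h2, finrank_bot, Nat.sub_zero] at h1
  exact h1

end Verma

/-- **`KacCharacter` from the existence of singular vectors**: the character formula
`χ_{r,s} = q^{h_{r,s}} (1 - q^{rs}) / ∏(1 - qⁿ)` of the Kac quotients follows from the existence,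
for all `t ≠ 0` and `r, s ≥ 1`, of a singular vector of level `rs` in `V(c(t), h_{r,s}(t))`
(Iohara–Koga Proposition 5.2). [cite: PearceRasmussenZuber2006, §2.2] [cite: IoharaKoga2011, Proposition 5.2 and Corollary 5.2] -/
theorem KacCharacter_of_exists_singular
    (H : ∀ (t : ℂ), t ≠ 0 → ∀ (r s : ℕ), 1 ≤ r → 1 ≤ s →
      ∃ w : Verma (centralChargeOf t) (kacWeight t r s), w ≠ 0 ∧
        (Verma.rep (centralChargeOf t) (kacWeight t r s)).IsPrimary w (kacWeight t r s + (r * s : ℕ))) :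
    KacCharacter := by
  intro t ht r s hr hs n
  obtain ⟨w, hw0, hprim⟩ := H t ht r s hr hs
  exact Verma.kacCharacter_of_singular t r s hw0 hprim n

/-- Conversely `KacCharacter` forces the existence of the level-`rs` singular vectors (at level
`n = rs` the formula reads `p(rs) - 1 ≠ p(rs)`). [cite: PearceRasmussenZuber2006, §2.2] -/
theorem exists_singular_of_KacCharacter (H : KacCharacter) (t : ℂ) (ht : t ≠ 0) (r s : ℕ)
    (hr : 1 ≤ r) (hs : 1 ≤ s) :
    ∃ w : Verma (centralChargeOf t) (kacWeight t r s), w ≠ 0 ∧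
      (Verma.rep (centralChargeOf t) (kacWeight t r s)).IsPrimary w (kacWeight t r s + (r * s : ℕ)) := by
  by_contra hne
  push Not at hne
  have hall : ∀ w : Verma (centralChargeOf t) (kacWeight t r s),
      (Verma.rep (centralChargeOf t) (kacWeight t r s)).IsPrimary w (kacWeight t r s + (r * s : ℕ)) → w = 0 :=
    fun w hw => by_contra fun hw0 => hne w hw0 hw
  have h1 := H t ht r s hr hs (r * s)
  rw [Verma.gradedDim_kacModule_of_forall_eq_zero t r s hall (r * s), if_pos le_rfl, Nat.sub_self] at h1
  have hcard : 1 ≤ Fintype.card (Nat.Partition 0) := Fintype.card_pos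
  have hcard' : 1 ≤ Fintype.card (Nat.Partition (r * s)) := Fintype.card_pos
  omega

/-- **`KacCharacter ↔` existence of the level-`rs` singular vectors** (Iohara–Koga
Proposition 5.2): the PBW theorem, torsion-freeness and the uniqueness of singular vectors reduce
the character of the Kac quotients exactly to the vanishing locus of the Kac determinant.
[cite: IoharaKoga2011, Proposition 5.2 and Theorem 4.2] [cite: PearceRasmussenZuber2006, §2.2] -/
theorem KacCharacter_iff_exists_singular :
    KacCharacter ↔ ∀ (t : ℂ), t ≠ 0 → ∀ (r s : ℕ), 1 ≤ r → 1 ≤ s →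
      ∃ w : Verma (centralChargeOf t) (kacWeight t r s), w ≠ 0 ∧
        (Verma.rep (centralChargeOf t) (kacWeight t r s)).IsPrimary w (kacWeight t r s + (r * s : ℕ)) :=
  ⟨exists_singular_of_KacCharacter, KacCharacter_of_exists_singular⟩

end Literature.RepresentationTheory.Virasoro

end
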